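import Summits.BirchSwinnertonDyer.Rank1Residual.GaloisImage.SmallImageCyclicInertia
import Summits.BirchSwinnertonDyer.Rank1Residual.GaloisImage.GL2F3ExponentEight
import HarnessLib

/-!
# The `p = 3` DICHOTOMY on a tame inertia image: `3 ∤ e₃ ⟹ e₃ = 2` (`E[3]|_I ≅ ω ⊕ 1`,
# `InertiaSplitAt`, NIVEAU 1) or `e₃ = 8` (`E[3]|_I ≅ 𝔽₉(ψ₂)`, no stable line, NIVEAU 2); image
# `3Ns ⟹ e₃ = 2` — part 6b of the O8-TAME kernel theorems, valid on EVERY O8 row at `3`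
# (cell `b2b-bsdres`, lane CLASS-CLOSURE, seat cc-typer-1 = typer of record N11 / O8;
# `class-closure/O8/STATEMENT.md` §19, census shadow NIV3 `class-closure/typer-1/NIV3-prereg-typer1.md`)

HONEST FRAMING (cell `b2b-bsdres`, run/shared/lean/b2b/bsd-rank1-residual/, verbatim in every
file): the goal of the cell is to DELETE the COMBINATION-SHAPED residual classes of the
Birch–Swinnerton-Dyer formula for ALL analytic-rank `≤ 1` elliptic curves over `ℚ` — "full BSD
formula for every rank `≤ 1` curve in class `C`" assembled STRICTLY from published theorems — so
that the rank-`≤ 1` remainder becomes exactly the CONSTRUCTION-SHAPED classes, which are TYPED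
(missing-input `Prop`s), NOT attempted. This is not "finishing BSD". Lane CLASS-CLOSURE: research
routes, no claim beyond the stated classes; census output = EVIDENCE, never a Literature fact;
NOTHING is booked here. This file contains THEOREMS ONLY (linear algebra on the `𝔽₃`-plane `E[3]`
over tree predicates, with part 6a's tame generator and the `GL₂(𝔽₃)` facts of
`GaloisImage/GL2F3ExponentEight`); no definition, no named fact, no conjecture, no `sorry`.

## What is proved (`E = W/ℚ` elliptic, `v ∋ 3`, `𝔓 ∣ v`, `I = I_𝔓`, `e₃ = #ρ̄_{E,3}(I)`)

* §2b `exists_mem_inertia_modPCyclotomicCharacterZMod_three_ne_one` — an inertia element at `3`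
  with `χ̄₃ ≠ 1` (the Kummer element of `√−3`, `exists_mem_inertia_smul_geomSqrt_eq_neg`, and
  `χ₋₃ = ω`, part 3's `smul_geomSqrt_neg_three_iff`); `inertiaSplitAt_three_of_involution` — an
  involution `s ≠ ±1` through which `I` acts gives `InertiaSplitAt W 3 I` (`(±1)`-eigen-subgroups,
  part 1's `exists_eigenAddSubgroup`, `#E[3] = 9`).
* §2c `card_inertia_map_three_eq_two_or_eq_eight` — **`3 ∤ e₃ ⟹ (e₃ = 2 ∧ InertiaSplitAt W 3 I) ∨
  (e₃ = 8 ∧` no `I`-stable line`)`**, for EVERY `E/ℚ` (stated with `p`, `hp3 : p = 3`); hence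
  `inertiaSplitAt_iff_card_inertia_map_eq_two`, `not_exists_stableLine_iff_card_inertia_map_eq_eight`.
  Proof: part 6a's generator `s` has `e₃ = ord ρ̄(s)`, `3 ∤ e₃`; in the frame
  `exists_frame_galoisRepTorsion_rat` (`det ρ̄ = χ̄₃`) the Kummer element forces `det ρ̄(s) ≠ 1`;
  `GL₂(𝔽₃)`: `ρ̄(s)⁸ = 1 ∨ ρ̄(s)⁶ = 1`, so `e₃ ∣ 8`, `e₃ ≠ 1` (det), `e₃ ≠ 4` (no element of order `4`
  has `det = −1`); `e₃ = 2`: `s` is an involution `≠ ±1` (`det(±1) = 1`), §2b; `e₃ = 8`: a stable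
  line has a stable complement (part 5) and then `s² = 1` (part 4).
* The `3Ns` consequence (`e₃ = 2`) and the small-image / O8 class forms are the sequel
  `GaloisImage/SmallImageNiveauDichotomyO8.lean`.

READING (class-closure, `O8/STATEMENT.md` §19, `O8/SUBPARTITION-typed.md` v1.8): O8's rows at the
additive prime split THEOREM-LEVEL into NIVEAU 1 (`e₃ = 2`: all `3Ns` rows, all (M)/`I₀*` rows —
parts 2–3 — and whichever `3Nn` potentially supersingular rows the census finds) and NIVEAU 2
(`e₃ = 8`, `E[3]|_{I}` irreducible — the rows on which every ORDINARY-type local hypothesis fails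
and the "`ρ̄|_{G_p}` irreducible" hypothesis of the non-ordinary literature holds); the census
shadow NIV3 decides the split per row.  Nothing about BSD_p; O8 / N2 / N3 stay OPEN; nothing booked.

References: J.-P. Serre, Invent. Math. 15 (1972) §1.3–§1.11 (tame inertia characters of niveau 1
and 2), §2.4 Prop. 15 [Serre1972]; J.-P. Serre, *Corps locaux* Ch. IV §2 [SerreLocalFields1979];
B. Edixhoven (1997) §4.2 [Edixhoven1997Serre]; Bilu–Parent–Rebolledo (2013) §1
[BiluParentRebolledo2013]; class-closure/O8/STATEMENT.md §§12–19.
-/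

noncomputable section

open scoped Classical NumberField Pointwise
open Field IsDedekindDomain WeierstrassCurve

namespace Summit.BirchSwinnertonDyer.Rank1Residual.GaloisImage

open Literature.NumberTheory.EllipticCurves Literature.NumberTheory.GaloisRepresentations
  Rat.HeightOneSpectrum NumberField
  Literature.NumberTheory.EllipticCurves.Rank1Residual
  Summit.BirchSwinnertonDyer.Rank1Residual.Additive.MixedCongruence

/-! ## §2b. Inputs at `p = 3`: a Kummer inertia element with `χ̄₃ ≠ 1`; `(±1)`-eigen-subgroups -/

section Three

variable {W : WeierstrassCurve ℚ} [W.IsElliptic]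

/-- **An inertia element at `3` on which the mod-`3` cyclotomic character is non-trivial**: the
Kummer element of `√−3` (`ord₃(−3) = 1`, `exists_mem_inertia_smul_geomSqrt_eq_neg`) moves `√−3`,
and `χ₋₃ = ω` (part 3, `smul_geomSqrt_neg_three_iff`). [folklore] -/
theorem exists_mem_inertia_modPCyclotomicCharacterZMod_three_ne_one
    {v : HeightOneSpectrum (𝓞 ℚ)} (hv : ((3 : ℕ) : 𝓞 ℚ) ∈ v.asIdeal)
    {𝔓 : Ideal (absIntegers (𝓞 ℚ) ℚ)} (h𝔓 : 𝔓 ∈ v.primesAbove) :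
    ∃ σ ∈ 𝔓.inertia (absoluteGaloisGroup ℚ), modPCyclotomicCharacterZMod ℚ 3 σ ≠ 1 := by
  haveI : Fact (Nat.Prime 3) := ⟨Nat.prime_three⟩
  have hγ : v.intValuation (((-3 : ℤ) : 𝓞 ℚ)) = WithZero.exp (-1 : ℤ) := by
    have h := Additive.intValuation_pStar 3 hv
    have e1 : ((((-1 : ℤ) ^ ((3 : ℕ) / 2) * (3 : ℕ) : ℤ)) : 𝓞 ℚ) = (((-3 : ℤ)) : 𝓞 ℚ) := by
      norm_num
    rwa [e1] at h
  have h2 : (2 : 𝓞 ℚ) ∉ v.asIdeal := two_not_mem_of_natCast_prime_mem (Fact.out) (by decide) hv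
  obtain ⟨σ, hσI, hσ⟩ := exists_mem_inertia_smul_geomSqrt_eq_neg hγ h2 h𝔓
  have hcoe : ((((-3 : ℤ) : 𝓞 ℚ) : 𝓞 ℚ) : ℚ) = (-3 : ℚ) := by
    rw [RingOfIntegers.coe_eq_algebraMap, map_intCast]
    norm_num
  rw [hcoe] at hσ
  refine ⟨σ, hσI, fun h1 ↦ ?_⟩
  have hfix : σ • geomSqrt (-3 : ℚ) = geomSqrt (-3 : ℚ) := (smul_geomSqrt_neg_three_iff σ).mpr h1
  rw [hfix] at hσ
  have hne : geomSqrt (-3 : ℚ) ≠ 0 := geomSqrt_ne_zero (by norm_num)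
  apply hne
  have h2x : (2 : AlgebraicClosure ℚ) * geomSqrt (-3 : ℚ) = 0 := by linear_combination hσ
  exact (mul_eq_zero.mp h2x).resolve_left two_ne_zero

omit [W.IsElliptic] in
/-- On `E[3]`, `P = −P ⟹ P = 0` (`2` is invertible mod `3`). [folklore] -/
theorem eq_zero_of_eq_neg_three {P : geomTorsion W ((3 : ℕ) : ℤ)} (h : P = -P) : P = 0 := by
  haveI : Fact (Nat.Prime 3) := ⟨Nat.prime_three⟩
  have h3 : ((3 : ℕ) : ℤ) • P = 0 := natCast_zsmul_eq_zero P
  have h2 : (2 : ℤ) • P = 0 := by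
    rw [two_zsmul]
    nth_rw 2 [h]
    exact add_neg_cancel P
  have key : P = ((3 : ℕ) : ℤ) • P - (2 : ℤ) • P := by push_cast; module
  rw [key, h3, h2, sub_zero]

/-- **`InertiaSplitAt` from an involution generating the action.** If every `x ∈ I` acts on `E[3]`
either trivially or as a fixed `s` with `s² = 1`, `s ≠ 1`, `s ≠ −1`, then `E[3] = X ⊕ Y` with
`X = {s = −1}` `I`-stable and `Y = {s = 1}` `I`-fixed: `InertiaSplitAt W 3 I`. [folklore] -/
theorem inertiaSplitAt_three_of_involution {I : Subgroup (absoluteGaloisGroup ℚ)}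
    {s : absoluteGaloisGroup ℚ}
    (hgen : ∀ x ∈ I, (∀ P : geomTorsion W ((3 : ℕ) : ℤ), x • P = P) ∨
      (∀ P : geomTorsion W ((3 : ℕ) : ℤ), x • P = s • P))
    (h2 : ∀ P : geomTorsion W ((3 : ℕ) : ℤ), s • (s • P) = P)
    (hn1 : ∃ P : geomTorsion W ((3 : ℕ) : ℤ), s • P ≠ P)
    (hn2 : ∃ P : geomTorsion W ((3 : ℕ) : ℤ), s • P ≠ -P) :
    InertiaSplitAt W 3 I := by
  haveI : Fact (Nat.Prime 3) := ⟨Nat.prime_three⟩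
  obtain ⟨X, hX⟩ := exists_eigenAddSubgroup (W := W) (p := 3) s (-1)
  obtain ⟨Y, hY⟩ := exists_eigenAddSubgroup (W := W) (p := 3) s 1
  have hXm : ∀ P, P ∈ X ↔ s • P = -P := fun P ↦ by rw [hX, neg_one_zsmul]
  have hYm : ∀ P, P ∈ Y ↔ s • P = P := fun P ↦ by rw [hY, one_zsmul]
  have h9 : Nat.card (geomTorsion W ((3 : ℕ) : ℤ)) = 9 := by
    rw [Literature.NumberTheory.EllipticCurves.natCard_geomTorsion W 3]; norm_num
  haveI : Finite (geomTorsion W ((3 : ℕ) : ℤ)) := Nat.finite_of_card_ne_zero (by rw [h9]; norm_num)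
  -- card of a subgroup which is neither `⊥` nor `⊤` is `3`
  have hcard3 : ∀ Z : AddSubgroup (geomTorsion W ((3 : ℕ) : ℤ)), Z ≠ ⊥ → Z ≠ ⊤ → Nat.card Z = 3 := by
    intro Z hb ht
    have hdvd : Nat.card Z ∣ 3 ^ 2 := by
      have := AddSubgroup.card_addSubgroup_dvd_card Z
      rwa [h9] at this
    obtain ⟨k, hk, hkZ⟩ := (Nat.dvd_prime_pow Nat.prime_three).mp hdvd
    interval_cases k
    · exact absurd (AddSubgroup.card_eq_one.mp (by rw [hkZ, pow_zero])) hb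
    · rw [hkZ, pow_one]
    · exfalso
      apply ht
      rw [← AddSubgroup.card_eq_iff_eq_top, h9, hkZ]
      norm_num
  obtain ⟨P₁, hP₁⟩ := hn1
  obtain ⟨P₂, hP₂⟩ := hn2
  -- `Y ≠ ⊥`: `s P₂ + P₂` is a non-zero fixed vector; `Y ≠ ⊤`: `P₁` is not fixed
  have hYb : Y ≠ ⊥ := by
    intro hb
    have hmem : s • P₂ + P₂ ∈ Y := by
      rw [hYm, smul_add, h2, add_comm]
    rw [hb, AddSubgroup.mem_bot] at hmem
    exact hP₂ (eq_neg_of_add_eq_zero_left hmem)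
  have hYt : Y ≠ ⊤ := by
    intro ht
    have : P₁ ∈ Y := ht ▸ AddSubgroup.mem_top P₁
    exact hP₁ ((hYm P₁).mp this)
  -- `X ≠ ⊥`: `s P₁ − P₁` is a non-zero antifixed vector; `X ≠ ⊤`: `P₂`
  have hXb : X ≠ ⊥ := by
    intro hb
    have hmem : s • P₁ - P₁ ∈ X := by
      rw [hXm, smul_sub, h2, neg_sub]
    rw [hb, AddSubgroup.mem_bot] at hmem
    exact hP₁ (sub_eq_zero.mp hmem)
  have hXt : X ≠ ⊤ := by
    intro ht
    have : P₂ ∈ X := ht ▸ AddSubgroup.mem_top P₂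
    exact hP₂ ((hXm P₂).mp this)
  refine ⟨X, Y, hcard3 X hXb hXt, hcard3 Y hYb hYt, ?_, ?_, ?_, ?_⟩
  · -- `X ⊓ Y = ⊥`
    rw [eq_bot_iff]
    intro P hP
    rw [AddSubgroup.mem_inf] at hP
    rw [AddSubgroup.mem_bot]
    have h1 : s • P = -P := (hXm P).mp hP.1
    have h2' : s • P = P := (hYm P).mp hP.2
    exact eq_zero_of_eq_neg_three (h2'.symm.trans h1)
  · -- `X ⊔ Y = ⊤`: `P = (sP − P) − (sP + P)` using `3P = 0`
    rw [eq_top_iff]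
    intro P _
    have hR : s • P - P ∈ X := by rw [hXm, smul_sub, h2, neg_sub]
    have hQ : -(s • P + P) ∈ Y := by rw [hYm, smul_neg, smul_add, h2, add_comm]
    have h3 : ((3 : ℕ) : ℤ) • P = 0 := natCast_zsmul_eq_zero P
    have hsum : ∀ A : geomTorsion W ((3 : ℕ) : ℤ),
        (A - P) + (-(A + P)) = P - ((3 : ℕ) : ℤ) • P := by
      intro A; push_cast; module
    have hsum' := hsum (s • P)
    rw [h3, sub_zero] at hsum'
    exact hsum' ▸ AddSubgroup.add_mem _ (AddSubgroup.mem_sup_left hR) (AddSubgroup.mem_sup_right hQ)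
  · -- `X` is `I`-stable
    intro σ hσ P hP
    rcases hgen σ hσ with h | h
    · rw [h P]; exact hP
    · rw [h P, (hXm P).mp hP]; exact X.neg_mem hP
  · -- `Y` is `I`-fixed
    intro σ hσ P hP
    rcases hgen σ hσ with h | h
    · exact h P
    · rw [h P]; exact (hYm P).mp hP

/-! ## §2c. The dichotomy `e₃ ∈ {2, 8}` -/

/-- **`3 ∤ e₃ ⟹ e₃ = 2 ∧ InertiaSplitAt`, or `e₃ = 8 ∧` no `I_𝔓`-stable line** (`p = 3`, every
`E/ℚ`; in particular every O8 / N2 row and every TAME row of N10 / N11).  With §1's generator `s`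
(`e₃ = ord ρ̄(s)`, `3 ∤ e₃`, `e₃ ∣ 48`): `ρ̄(s)⁸ = 1` or `ρ̄(s)⁶ = 1` (§2a), so `e₃ ∣ 8`; the Kummer
element of `√−3` lies in `⟨s⟩ · ker ρ̄` and has `χ̄₃ ≠ 1`, so `det ρ̄(s) = χ̄₃(s) ≠ 1`, which rules
out `e₃ = 1` and (§2a, certificate B) `e₃ = 4`; `e₃ = 2` gives the `(±1)`-eigen-decomposition
(`s ≠ ±1` because `det(±1) = 1`), `e₃ = 8` forbids a stable line (a stable line has a stable
complement, part 5, and then `s² = 1`, part 4).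
[cite: Serre1972, §1.3–§1.11 (tame inertia characters of niveau 1 and 2)]
[cite: SerreLocalFields1979, Ch. IV §2 Prop. 7, Cor. 1 and Cor. 3] -/
theorem card_inertia_map_three_eq_two_or_eq_eight {p : ℕ} [Fact p.Prime] (hp3 : p = 3)
    {v : HeightOneSpectrum (𝓞 ℚ)} (hv : ((p : ℕ) : 𝓞 ℚ) ∈ v.asIdeal)
    {𝔓 : Ideal (absIntegers (𝓞 ℚ) ℚ)} (h𝔓 : 𝔓 ∈ v.primesAbove)
    (hI : ¬ p ∣ Nat.card ((𝔓.inertia (absoluteGaloisGroup ℚ)).map (galoisRepTorsion W p))) :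
    (Nat.card ((𝔓.inertia (absoluteGaloisGroup ℚ)).map (galoisRepTorsion W p)) = 2 ∧
        InertiaSplitAt W p (𝔓.inertia (absoluteGaloisGroup ℚ))) ∨
      (Nat.card ((𝔓.inertia (absoluteGaloisGroup ℚ)).map (galoisRepTorsion W p)) = 8 ∧
        ¬ ∃ L : AddSubgroup (geomTorsion W (p : ℤ)), Nat.card L = p ∧
          ∀ σ ∈ 𝔓.inertia (absoluteGaloisGroup ℚ), ∀ P ∈ L, σ • P ∈ L) := by
  subst hp3
  set I := 𝔓.inertia (absoluteGaloisGroup ℚ) with hIdef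
  obtain ⟨s, hsI, hgen, hcard⟩ := exists_card_inertia_map_eq_orderOf_of_not_dvd_card hv h𝔓 hI
  -- the frame `Aut(E[3]) ≅ GL₂(𝔽₃)` with `det ∘ Φ ∘ ρ̄ = χ̄₃`
  obtain ⟨e, Φ, he, -, hdet, -⟩ := exists_frame_galoisRepTorsion_rat W 3
  set g := galoisRepTorsion W ((3 : ℕ) : ℤ) s with hg
  -- `det Φ g ≠ 1` (Kummer element)
  have hdetg : Matrix.GeneralLinearGroup.det (Φ g) ≠ 1 := by
    intro h1
    obtain ⟨σ₁, hσ₁I, hσ₁⟩ := exists_mem_inertia_modPCyclotomicCharacterZMod_three_ne_one hv h𝔓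
    obtain ⟨k, hk⟩ := hgen σ₁ hσ₁I
    apply hσ₁
    rw [← hdet σ₁, hk, map_zpow, map_zpow, h1, one_zpow]
  -- `e₃ = ord g` divides `8`
  have h3 : ¬ 3 ∣ orderOf g := by rw [← hcard]; exact hI
  have h8 : orderOf g ∣ 8 := by
    rcases GL2F3Cyc.pow_eight_eq_one_or_pow_six_eq_one_of_injective Φ.toMonoidHom Φ.injective g
      with h | h
    · exact orderOf_dvd_of_pow_eq_one h
    · have h6 : orderOf g ∣ 2 * 3 := orderOf_dvd_of_pow_eq_one h
      have hcop : Nat.Coprime (orderOf g) 3 :=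
        ((Nat.Prime.coprime_iff_not_dvd Nat.prime_three).mpr h3).symm
      exact (hcop.dvd_of_dvd_mul_right h6).trans (by norm_num)
  -- `e₃ ≠ 1`, `e₃ ≠ 4`
  have hne1 : orderOf g ≠ 1 := by
    intro h1
    apply hdetg
    rw [orderOf_eq_one_iff.mp h1, map_one, map_one]
  have hne4 : orderOf g ≠ 4 := by
    intro h4
    have hp4 : g ^ 4 = 1 := by rw [← h4]; exact pow_orderOf_eq_one g
    have h2 := GL2F3Cyc.sq_eq_one_of_pow_four_eq_one_of_det_ne_one_of_injective Φ.toMonoidHom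
      Φ.injective g hp4 hdetg
    have : orderOf g ∣ 2 := orderOf_dvd_of_pow_eq_one h2
    rw [h4] at this
    norm_num at this
  have h28 : orderOf g = 2 ∨ orderOf g = 8 := by
    obtain ⟨k, hk, hk'⟩ := (Nat.dvd_prime_pow Nat.prime_two).mp (show orderOf g ∣ 2 ^ 3 from h8)
    interval_cases k
    · exact absurd hk' hne1
    · exact Or.inl hk'
    · exact absurd hk' hne4
    · exact Or.inr hk'
  rcases h28 with h2 | h8'
  · -- `e₃ = 2`: `s` is an involution, `≠ ±1`
    left
    refine ⟨by rw [hcard, h2], ?_⟩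
    have hs2 : ∀ P : geomTorsion W ((3 : ℕ) : ℤ), s • (s • P) = P := by
      intro P
      have h1 : galoisRepTorsion W ((3 : ℕ) : ℤ) (s ^ 2) = 1 := by
        rw [map_pow, ← hg, ← h2, pow_orderOf_eq_one]
      have := (galoisRepTorsion_eq_one_iff' W _ (s ^ 2)).mp h1 P
      rwa [sq, mul_smul] at this
    have hgen' : ∀ x ∈ I, (∀ P : geomTorsion W ((3 : ℕ) : ℤ), x • P = P) ∨
        (∀ P : geomTorsion W ((3 : ℕ) : ℤ), x • P = s • P) := by
      intro x hx
      obtain ⟨k, hk⟩ := hgen x hx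
      rw [← zpow_mod_orderOf, h2] at hk
      rcases Int.emod_two_eq_zero_or_one k with h0 | h1
      · left
        rw [show ((2 : ℕ) : ℤ) = 2 from rfl, h0, zpow_zero] at hk
        exact (galoisRepTorsion_eq_one_iff' W _ x).mp hk
      · right
        intro P
        rw [show ((2 : ℕ) : ℤ) = 2 from rfl, h1, zpow_one] at hk
        have hx := galoisRepTorsion_apply W ((3 : ℕ) : ℤ) x P
        have hs := galoisRepTorsion_apply W ((3 : ℕ) : ℤ) s P
        rw [← hx, ← hs, hk, hg]
    have hn1 : ∃ P : geomTorsion W ((3 : ℕ) : ℤ), s • P ≠ P := by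
      by_contra h
      push Not at h
      apply hne1
      rw [hg, orderOf_eq_one_iff]
      exact (galoisRepTorsion_eq_one_iff' W _ s).mpr h
    have hn2 : ∃ P : geomTorsion W ((3 : ℕ) : ℤ), s • P ≠ -P := by
      by_contra h
      push Not at h
      apply hdetg
      -- `Φ g = −1`, whose determinant is `1`
      set M : Matrix (Fin 2) (Fin 2) (ZMod 3) := (Φ g : Matrix (Fin 2) (Fin 2) (ZMod 3)) with hM
      have hMv : ∀ w : Fin 2 → ZMod 3, M.mulVec w = -w := by
        intro w
        have h1 := he g (e.symm w)
        rw [AddEquiv.apply_symm_apply] at h1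
        rw [← h1, hg, galoisRepTorsion_apply W ((3 : ℕ) : ℤ) s (e.symm w), h, map_neg,
          AddEquiv.apply_symm_apply]
      have h00 : M 0 0 = -1 := by
        have := congrFun (hMv ![1, 0]) 0
        simpa [Matrix.mulVec, dotProduct, Fin.sum_univ_two] using this
      have h10 : M 1 0 = 0 := by
        have := congrFun (hMv ![1, 0]) 1
        simpa [Matrix.mulVec, dotProduct, Fin.sum_univ_two] using this
      have h01 : M 0 1 = 0 := by
        have := congrFun (hMv ![0, 1]) 0
        simpa [Matrix.mulVec, dotProduct, Fin.sum_univ_two] using this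
      have h11 : M 1 1 = -1 := by
        have := congrFun (hMv ![0, 1]) 1
        simpa [Matrix.mulVec, dotProduct, Fin.sum_univ_two] using this
      apply Units.ext
      rw [Matrix.GeneralLinearGroup.val_det_apply, Units.val_one, Matrix.det_fin_two, ← hM, h00, h01,
        h10, h11]
      ring
    exact inertiaSplitAt_three_of_involution hgen' hs2 hn1 hn2
  · -- `e₃ = 8`: no stable line
    right
    refine ⟨by rw [hcard, h8'], ?_⟩
    rintro ⟨L, hL, hst⟩
    obtain ⟨Y, hY, hinf, hsup, hYst⟩ := exists_stable_complement_of_stableLine_of_not_dvd_card hI hL hst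
    have h2 : g ^ 2 = 1 := by
      rw [hg, ← map_pow, galoisRepTorsion_eq_one_iff' W ((3 : ℕ) : ℤ) (s ^ 2)]
      intro P
      exact pow_sub_one_smul_eq_self_of_stablePair ⟨L, Y, hL, hY, hinf, hsup, hst, hYst⟩ hsI P
    have : orderOf g ∣ 2 := orderOf_dvd_of_pow_eq_one h2
    rw [h8'] at this
    norm_num at this

/-- **`3 ∤ e₃`: TAME-SPLIT ⟺ `e₃ = 2`.** [cite: Serre1972, §1.3–§1.11] -/
theorem inertiaSplitAt_iff_card_inertia_map_eq_two {p : ℕ} [Fact p.Prime] (hp3 : p = 3)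
    {v : HeightOneSpectrum (𝓞 ℚ)} (hv : ((p : ℕ) : 𝓞 ℚ) ∈ v.asIdeal)
    {𝔓 : Ideal (absIntegers (𝓞 ℚ) ℚ)} (h𝔓 : 𝔓 ∈ v.primesAbove)
    (hI : ¬ p ∣ Nat.card ((𝔓.inertia (absoluteGaloisGroup ℚ)).map (galoisRepTorsion W p))) :
    InertiaSplitAt W p (𝔓.inertia (absoluteGaloisGroup ℚ)) ↔
      Nat.card ((𝔓.inertia (absoluteGaloisGroup ℚ)).map (galoisRepTorsion W p)) = 2 := by
  rcases card_inertia_map_three_eq_two_or_eq_eight (W := W) hp3 hv h𝔓 hI with ⟨h2, hs⟩ | ⟨h8, hns⟩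
  · exact ⟨fun _ ↦ h2, fun _ ↦ hs⟩
  · constructor
    · intro hs
      obtain ⟨X, Y, hX, -, -, -, hXst, -⟩ := hs
      exact absurd ⟨X, hX, hXst⟩ hns
    · intro h2; rw [h8] at h2; norm_num at h2

/-- **`3 ∤ e₃`: NIVEAU 2 (no `I_𝔓`-stable line) ⟺ `e₃ = 8`.** [cite: Serre1972, §1.3–§1.11] -/
theorem not_exists_stableLine_iff_card_inertia_map_eq_eight {p : ℕ} [Fact p.Prime] (hp3 : p = 3)
    {v : HeightOneSpectrum (𝓞 ℚ)} (hv : ((p : ℕ) : 𝓞 ℚ) ∈ v.asIdeal)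
    {𝔓 : Ideal (absIntegers (𝓞 ℚ) ℚ)} (h𝔓 : 𝔓 ∈ v.primesAbove)
    (hI : ¬ p ∣ Nat.card ((𝔓.inertia (absoluteGaloisGroup ℚ)).map (galoisRepTorsion W p))) :
    (¬ ∃ L : AddSubgroup (geomTorsion W (p : ℤ)), Nat.card L = p ∧
        ∀ σ ∈ 𝔓.inertia (absoluteGaloisGroup ℚ), ∀ P ∈ L, σ • P ∈ L) ↔
      Nat.card ((𝔓.inertia (absoluteGaloisGroup ℚ)).map (galoisRepTorsion W p)) = 8 := by
  rcases card_inertia_map_three_eq_two_or_eq_eight (W := W) hp3 hv h𝔓 hI with ⟨h2, hs⟩ | ⟨h8, hns⟩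
  · constructor
    · intro hns
      obtain ⟨X, Y, hX, -, -, -, hXst, -⟩ := hs
      exact absurd ⟨X, hX, hXst⟩ hns
    · intro h8; rw [h2] at h8; norm_num at h8
  · exact ⟨fun _ ↦ h8, fun _ ↦ hns⟩

end Three

end Summit.BirchSwinnertonDyer.Rank1Residual.GaloisImage

end
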